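import Summits.QuantumFields.YangMills.Theorems.BalabanUVNodesN15KingModelHeatKernelGradientGreenPowerLaw
import Summits.QuantumFields.YangMills.Theorems.BalabanUVNodesN15KingModelHeatKernelBlockCovPowerLaw
import HarnessLib

/-!
# BalabanUVNodes ∕ N15 — THE KING-MODEL RUNG (PART ∇-g): ★★★★ THE η-UNIFORM INVERSE-CUBE LAW FOR THE BLOCK GRADIENT OF NE2's UNIT LAYER — King's block-field covariance `C = (Δ^{(K)})⁻¹`:
# `|(C − a⁻¹1)(y+ê_ν,y′) − (C − a⁻¹1)(y,y′)| ≤ (316160000 + 128∕m²)∕(1 + dist_M(y,y′))³` on the block torus `(ℤ∕M₀)⁴`, for EVERY block size `L ≥ 1`, EVERY volume `M₀ ≥ 1`, both slots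
# (PART ∇-f's inverse-cube law for `∇G` summed over the `L⁴ × L⁴` site pairs of two blocks, `L` fine steps per block step)
# (Track A, DAG node N15 = NE2; FAN-OUT v1.1 §N15 s3 «KING-MODEL RUNG … + what the curved case adds»; count-neutral)

HONEST FRAMING.  Count-neutral (cell `pub-ymgap`, seat `pub-ymgap-dag-n15-e` g57; `--supports stmt-QuantumFields-27247 --as helper` = K3ᴬ, KEY MAP v3).  King's `A = 0` comparison model:
the covariance of the block field after ONE renormalization step, `C = (Δ_eff)⁻¹ = a⁻¹1 + L^{d+1}QGQᵀ` ([King1986] (2.14) p.653, (4.44)–(4.45) p.675), whose off-noise part is the block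
double sum `W(y,y′) := (C − a⁻¹1)(y,y′) = L^{−4}Σ_{j,j′}G(x_j,x′_{j′})` (Ϥ-l `king_blockCov_sub_noise_apply`); cubic tori `(ℤ∕LM₀)⁴ → (ℤ∕M₀)⁴`, King's scaling `c = L²`; NOT Bałaban's `C^{(k)}(U)`;
NOT a node discharge.  WHAT IS NEW: PART Ϻ-e gave the η-uniform inverse-SQUARE law `0 ≤ W(y,y′) ≤ 8C₀∕(1+dist_M²)`; this file gives the inverse-CUBE law for its BLOCK GRADIENT
`W(y+ê_ν,y′) − W(y,y′)` — the η-uniform cluster property of the block field's covariance one derivative up, in BLOCK units, uniformly in the spacing `η = 1∕L` of the fine field.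
THE MECHANISM: (i) a block step is `L` fine steps: `site(y+ê_ν) j = site y j + L·e_ν` (★ `site_add_unitVec_eq_add_nsmul`; the wrap-around of the coarse coordinate is invisible on the fine torus,
`L·M₀ ≡ 0`); (ii) telescoping `G(u+L·e,x′) − G(u,x′) = Σ_{t<L}[G(u+(t+1)e,x′) − G(u+te,x′)]` and PART ∇-f on each term: `L²|∇G(u+te,x′)| ≤ C_∇∕(1+tdistT(u+te,x′))³`, `C_∇ = 4940000`; (iii) GEOMETRY:
`tdistT(u+te, x′) ≥ tdistT(u,x′) − t ≥ L·D − 2(L−1)` (`mul_tdistT_blocks_le`, `tdistT_add_unitVec_le` iterated) and for `D = dist_M(y,y′) ≥ 3`: `1 + L·D − 2(L−1) ≥ L·D∕3`, so each term is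
`≤ 27C_∇∕(L⁵D³)`, the `L` terms give `27C_∇∕(L⁴D³)`, the `L⁴·L⁴` site pairs and the prefactor `L^{−4}` give `27C_∇∕D³ ≤ 64C_∇∕(1+D)³`; (iv) NEAR (`D < 3`): `|∇W| ≤ 2∕m²` (Ϻ-e: `0 ≤ W ≤ 1∕m²`)
`≤ 128m⁻²∕(1+D)³`; (v) the second slot by the symmetry `W(y,y′) = W(y′,y)` (`lapF_inv_comm`).
CONTENTS.  §1 ★ `site_add_unitVec_eq_add_nsmul`, `tdistT_add_nsmul_unitVec_le`; §2 ★★ `abs_lapF_inv_blockShift_sub_le` (the telescoped far bound `27C_∇∕(L⁴D³)`); §3 ★ `king_blockCov_sub_noise_symm`,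
★★ `abs_blockCov_grad_le_far`, ★★ `abs_blockCov_grad_le_near`, ★★★★ **`king_blockCov_grad_powerLaw_eta_uniform`** (first slot), ★★★★ **`king_blockCov_grad_snd_powerLaw_eta_uniform`** (second slot),
★★★ `king_blockCov_grad_what_the_curved_case_adds`.
PRIOR TREE ART (by name): Ϥ-l `king_blockCov_sub_noise_apply`, Ϻ-e `king_blockCov_sub_noise_nonneg` ∕ `king_blockCov_sub_noise_le_inv_mass`, Ϻ-c `card_offsets_four`, King1986 `site` ∕ `val_site` ∕
`mul_tdistT_blocks_le` ∕ `tdistT_triangle` ∕ `tdistT_symm` ∕ `tdistT_add_unitVec_le`, Ν-a `lapF_inv_comm`, ∇-f `king_green_grad_powerLaw_tdistT`; the one-liner `L·((v+1) mod M) ≡ L·(v+1) (mod LM)` is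
n15-b's `KingTorusLine.cast_mul_succ_mod` (cited; inlined, not imported).
Dedup (rg at filing): basename 0 files; needles `king_blockCov_grad|site_add_unitVec_eq_add_nsmul|abs_lapF_inv_blockShift_sub_le|tdistT_add_nsmul_unitVec_le|king_blockCov_sub_noise_symm` 0 tree files.
Locators: [King1986] (2.13)–(2.14) p.653, (4.34) p.674, (4.44)–(4.45) p.675, (3.63) p.663; [Balaban1984PropagatorsI] (1.29) p.23.  0 `sorry`, 0 `def`.
-/

noncomputable section

open Real Finset Matrix
open scoped BigOperators

namespace Summit.QuantumFields.YangMills.BalabanUVNodes.N15KingModelRung.HeatKernel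

open Literature.MathematicalPhysics.QuantumFieldTheory.Balaban1983to89.B5Prop11Plancherel (Tor fine unitVec)
open Literature.MathematicalPhysics.QuantumFieldTheory.Balaban1983to89.Beta.WoodburyFibre (cM)
open Literature.MathematicalPhysics.QuantumFieldTheory.King1986.Torus (lapF effLaplacian site mul_tdistT_blocks_le tdistT tdistT_nonneg tdistT_triangle tdistT_symm tdistT_add_unitVec_le)
open Summit.QuantumFields.YangMills.BalabanUVNodes.N15KingModelRung.CovariantBlock (king_blockCov_sub_noise_apply)
open Summit.QuantumFields.YangMills.BalabanUVNodes.N15KingModelRung.TorusSpectral (lapF_inv_comm)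

/-! ## §1 A block step is `L` fine steps; the torus distance under `t` unit steps -/

section Sites

variable {d : ℕ} (L : ℕ) [NeZero L] (M : Fin (d + 1) → ℕ) [hM : ∀ μ, NeZero (M μ)]

omit [NeZero L] in
/-- ★ **A BLOCK STEP IS `L` FINE STEPS**: `site(y + ê_ν) j = site y j + L·e_ν` on the fine torus (the coarse wrap-around `M_ν ≡ 0` is invisible since `L·M_ν ≡ 0` on `ℤ∕(LM_ν)`; cf. n15-b's
`KingTorusLine.site_add_unitVec_of_eq`, the one-step version). [folklore] -/
theorem site_add_unitVec_eq_add_nsmul (y : Tor M) (j : Fin (d + 1) → Fin L) (ν : Fin (d + 1)) :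
    site L M (y + unitVec M ν) j = site L M y j + L • unitVec (fine L M) ν := by
  funext μ
  by_cases hμ : μ = ν
  · subst hμ
    rw [Pi.add_apply, Pi.smul_apply]
    show ((L * ((y + unitVec M μ) μ).val + (j μ : ℕ) : ℕ) : ZMod (L * M μ)) = ((L * (y μ).val + (j μ : ℕ) : ℕ) : ZMod (L * M μ)) + L • (unitVec (fine L M) μ μ)
    have h1 : (y + unitVec M μ) μ = y μ + 1 := by simp [unitVec]
    have h2 : unitVec (fine L M) μ μ = 1 := by simp [unitVec]
    rw [h1, h2, ZMod.val_add, ZMod.val_one_eq_one_mod, Nat.add_mod_mod, nsmul_eq_mul, mul_one]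
    -- `L·((v+1) mod M) ≡ L·(v+1)` modulo `L·M` (n15-b's `cast_mul_succ_mod`, inlined)
    have hcast : ((L * (((y μ).val + 1) % M μ) : ℕ) : ZMod (L * M μ)) = ((L * ((y μ).val + 1) : ℕ) : ZMod (L * M μ)) := by
      rw [ZMod.natCast_eq_natCast_iff', Nat.mul_mod_mul_left, Nat.mul_mod_mul_left, Nat.mod_mod]
    push_cast at hcast ⊢
    rw [hcast]
    ring
  · rw [Pi.add_apply, Pi.smul_apply]
    have h1 : (y + unitVec M ν) μ = y μ := by simp [unitVec, Pi.single_eq_of_ne hμ]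
    have h2 : unitVec (fine L M) ν μ = 0 := by simp [unitVec, Pi.single_eq_of_ne hμ]
    rw [h2, smul_zero, add_zero]
    show ((L * ((y + unitVec M ν) μ).val + (j μ : ℕ) : ℕ) : ZMod (fine L M μ)) = ((L * (y μ).val + (j μ : ℕ) : ℕ) : ZMod (fine L M μ))
    rw [h1]

end Sites

section Steps

variable {d : ℕ} (K : Fin (d + 1) → ℕ) [hK : ∀ μ, NeZero (K μ)]

/-- `tdistT(u, u + t·e_ν) ≤ t`: `t` unit steps move a point by at most `t` (`tdistT_add_unitVec_le` and the triangle inequality). [folklore] -/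
theorem tdistT_add_nsmul_unitVec_le (u : Tor K) (ν : Fin (d + 1)) (t : ℕ) : tdistT K u (u + t • unitVec K ν) ≤ t := by
  induction t with
  | zero => simp [Literature.MathematicalPhysics.QuantumFieldTheory.King1986.Torus.tdistT_self]
  | succ t ih =>
    have h1 := tdistT_triangle K u (u + t • unitVec K ν) (u + (t + 1) • unitVec K ν)
    have h2 : tdistT K (u + t • unitVec K ν) (u + (t + 1) • unitVec K ν) ≤ 1 := by
      rw [succ_nsmul, ← add_assoc]
      exact tdistT_add_unitVec_le K (u + t • unitVec K ν) ν
    push_cast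
    linarith

/-- Hence `tdistT(u + t·e_ν, x′) ≥ tdistT(u,x′) − t`. [folklore] -/
theorem tdistT_add_nsmul_unitVec_ge (u x' : Tor K) (ν : Fin (d + 1)) (t : ℕ) : tdistT K u x' - t ≤ tdistT K (u + t • unitVec K ν) x' := by
  have h1 := tdistT_triangle K u (u + t • unitVec K ν) x'
  have h2 := tdistT_add_nsmul_unitVec_le K u ν t
  linarith

end Steps

/-! ## §2 The telescoped far bound for `G(u + L·e_ν, x′) − G(u, x′)` -/

section Telescope

variable (L M₀ : ℕ) [NeZero L] [NeZero M₀] {m2 : ℝ}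

/-- Telescoping along `L` unit steps: `G(u+L·e,x′) − G(u,x′) = Σ_{t<L}[G(u+(t+1)e,x′) − G(u+te,x′)]`. [folklore] -/
theorem lapF_inv_blockShift_sub_eq_sum (u x' : Tor (fine L (cM M₀))) (ν : Fin 4) :
    (lapF (fine L (cM M₀)) ((L : ℝ) ^ 2) m2)⁻¹ (u + L • unitVec (fine L (cM M₀)) ν) x' - (lapF (fine L (cM M₀)) ((L : ℝ) ^ 2) m2)⁻¹ u x'
      = ∑ t ∈ Finset.range L, ((lapF (fine L (cM M₀)) ((L : ℝ) ^ 2) m2)⁻¹ (u + t • unitVec (fine L (cM M₀)) ν + unitVec (fine L (cM M₀)) ν) x'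
          - (lapF (fine L (cM M₀)) ((L : ℝ) ^ 2) m2)⁻¹ (u + t • unitVec (fine L (cM M₀)) ν) x') := by
  have h := Finset.sum_range_sub (fun t => (lapF (fine L (cM M₀)) ((L : ℝ) ^ 2) m2)⁻¹ (u + t • unitVec (fine L (cM M₀)) ν) x') L
  simp only [zero_smul, add_zero] at h
  rw [← h]
  refine Finset.sum_congr rfl fun t _ => ?_
  rw [succ_nsmul, ← add_assoc]

/-- ★★ **THE FAR BOUND FOR ONE BLOCK SHIFT**: if `tdistT(u,x′) ≥ L·D − (L−1)` with `D ≥ 3` then `|G(u+L·e_ν,x′) − G(u,x′)| ≤ 27·4940000∕(L⁴D³)` — each of the `L` unit-step gradients sits at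
fine distance `≥ L·D − 2(L−1) ≥ L·D∕3 − 1` and costs `L⁻²·4940000·27∕(LD)³` (PART ∇-f). [cite: King1986, (2.13) p.653, (4.4) p.670, (3.63) p.663] -/
theorem abs_lapF_inv_blockShift_sub_le (hm : 0 < m2) (u x' : Tor (fine L (cM M₀))) (ν : Fin 4) {D : ℝ} (hD : 3 ≤ D)
    (hfar : (L : ℝ) * D - ((L : ℝ) - 1) ≤ tdistT (fine L (cM M₀)) u x') :
    |(lapF (fine L (cM M₀)) ((L : ℝ) ^ 2) m2)⁻¹ (u + L • unitVec (fine L (cM M₀)) ν) x' - (lapF (fine L (cM M₀)) ((L : ℝ) ^ 2) m2)⁻¹ u x'|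
      ≤ 27 * 4940000 / ((L : ℝ) ^ 4 * D ^ 3) := by
  have hL : (0 : ℝ) < L := by exact_mod_cast Nat.pos_of_ne_zero (NeZero.ne L)
  have hL1 : (1 : ℝ) ≤ L := by exact_mod_cast Nat.one_le_iff_ne_zero.mpr (NeZero.ne L)
  have hD0 : 0 < D := by linarith
  rw [lapF_inv_blockShift_sub_eq_sum L M₀ u x' ν]
  -- each term
  have hterm : ∀ t ∈ Finset.range L, |(lapF (fine L (cM M₀)) ((L : ℝ) ^ 2) m2)⁻¹ (u + t • unitVec (fine L (cM M₀)) ν + unitVec (fine L (cM M₀)) ν) x'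
        - (lapF (fine L (cM M₀)) ((L : ℝ) ^ 2) m2)⁻¹ (u + t • unitVec (fine L (cM M₀)) ν) x'| ≤ 27 * 4940000 / ((L : ℝ) ^ 5 * D ^ 3) := by
    intro t ht
    have htL : (t : ℝ) ≤ (L : ℝ) - 1 := by
      have : t + 1 ≤ L := Finset.mem_range.mp ht
      have : ((t : ℕ) : ℝ) + 1 ≤ L := by exact_mod_cast this
      linarith
    set w := u + t • unitVec (fine L (cM M₀)) ν with hw
    have hge := tdistT_add_nsmul_unitVec_ge (fine L (cM M₀)) u x' ν t
    have hdist : (L : ℝ) * D / 3 ≤ 1 + tdistT (fine L (cM M₀)) w x' := by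
      have : (L : ℝ) * D - 2 * ((L : ℝ) - 1) ≤ tdistT (fine L (cM M₀)) w x' := by rw [hw]; linarith
      nlinarith
    have hgrad := king_green_grad_powerLaw_tdistT L M₀ hm w x' ν
    have hpow : ((L : ℝ) * D / 3) ^ 3 ≤ (1 + tdistT (fine L (cM M₀)) w x') ^ 3 := pow_le_pow_left₀ (by positivity) hdist 3
    have hc : (0 : ℝ) < (L : ℝ) ^ 2 := by positivity
    have h1 : (L : ℝ) ^ 2 * |(lapF (fine L (cM M₀)) ((L : ℝ) ^ 2) m2)⁻¹ (w + unitVec (fine L (cM M₀)) ν) x' - (lapF (fine L (cM M₀)) ((L : ℝ) ^ 2) m2)⁻¹ w x'|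
        ≤ 4940000 / ((L : ℝ) * D / 3) ^ 3 := hgrad.trans (div_le_div_of_nonneg_left (by norm_num) (by positivity) hpow)
    rw [← le_div_iff₀' hc] at h1
    refine h1.trans (le_of_eq ?_)
    field_simp
    ring
  calc |∑ t ∈ Finset.range L, ((lapF (fine L (cM M₀)) ((L : ℝ) ^ 2) m2)⁻¹ (u + t • unitVec (fine L (cM M₀)) ν + unitVec (fine L (cM M₀)) ν) x'
          - (lapF (fine L (cM M₀)) ((L : ℝ) ^ 2) m2)⁻¹ (u + t • unitVec (fine L (cM M₀)) ν) x')|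
      ≤ ∑ t ∈ Finset.range L, |(lapF (fine L (cM M₀)) ((L : ℝ) ^ 2) m2)⁻¹ (u + t • unitVec (fine L (cM M₀)) ν + unitVec (fine L (cM M₀)) ν) x'
          - (lapF (fine L (cM M₀)) ((L : ℝ) ^ 2) m2)⁻¹ (u + t • unitVec (fine L (cM M₀)) ν) x'| := Finset.abs_sum_le_sum_abs _ _
    _ ≤ ∑ _t ∈ Finset.range L, 27 * 4940000 / ((L : ℝ) ^ 5 * D ^ 3) := Finset.sum_le_sum hterm
    _ = L * (27 * 4940000 / ((L : ℝ) ^ 5 * D ^ 3)) := by rw [Finset.sum_const, Finset.card_range, nsmul_eq_mul]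
    _ = 27 * 4940000 / ((L : ℝ) ^ 4 * D ^ 3) := by field_simp

end Telescope

/-! ## §3 The block gradient of the unit layer -/

section UnitLayer

variable (L M₀ : ℕ) [NeZero L] [NeZero M₀] {a m2 : ℝ}

/-- ★ SYMMETRY OF THE UNIT LAYER: `(C − a⁻¹1)(y,y′) = (C − a⁻¹1)(y′,y)` (the block double sum of the symmetric `G`). [cite: King1986, (2.14) p.653, (4.45) p.675] -/
theorem king_blockCov_sub_noise_symm (ha : 0 < a) (hm : 0 < m2) (y y' : Tor (cM M₀)) :
    ((effLaplacian L (cM M₀) a ((L : ℝ) ^ 2) m2)⁻¹ - a⁻¹ • (1 : Matrix (Tor (cM M₀)) (Tor (cM M₀)) ℝ)) y y'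
      = ((effLaplacian L (cM M₀) a ((L : ℝ) ^ 2) m2)⁻¹ - a⁻¹ • (1 : Matrix (Tor (cM M₀)) (Tor (cM M₀)) ℝ)) y' y := by
  have hL : 1 ≤ L := Nat.one_le_iff_ne_zero.mpr (NeZero.ne L)
  rw [king_blockCov_sub_noise_apply (cM M₀) hL ha hm y y', king_blockCov_sub_noise_apply (cM M₀) hL ha hm y' y, Finset.sum_comm]
  congr 1
  refine Finset.sum_congr rfl fun j' _ => Finset.sum_congr rfl fun j _ => ?_
  exact lapF_inv_comm (fine L (cM M₀)) _ _ _ _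

/-- ★★ THE FAR ZONE OF THE BLOCK GRADIENT (`dist_M(y,y′) ≥ 3`): `|(C−a⁻¹1)(y+ê_ν,y′) − (C−a⁻¹1)(y,y′)| ≤ 27·4940000∕dist_M(y,y′)³` — the `L⁴·L⁴` site pairs, §2 on each, the prefactor `L⁻⁴`.
[cite: King1986, (2.13)–(2.14) p.653, (4.45) p.675, (3.63) p.663] -/
theorem abs_blockCov_grad_le_far (ha : 0 < a) (hm : 0 < m2) (y y' : Tor (cM M₀)) (ν : Fin 4) (hD : 3 ≤ tdistT (cM M₀) y y') :
    |((effLaplacian L (cM M₀) a ((L : ℝ) ^ 2) m2)⁻¹ - a⁻¹ • (1 : Matrix (Tor (cM M₀)) (Tor (cM M₀)) ℝ)) (y + unitVec (cM M₀) ν) y'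
        - ((effLaplacian L (cM M₀) a ((L : ℝ) ^ 2) m2)⁻¹ - a⁻¹ • (1 : Matrix (Tor (cM M₀)) (Tor (cM M₀)) ℝ)) y y'|
      ≤ 27 * 4940000 / tdistT (cM M₀) y y' ^ 3 := by
  have hL : 1 ≤ L := Nat.one_le_iff_ne_zero.mpr (NeZero.ne L)
  have hLr : (0 : ℝ) < L := by exact_mod_cast Nat.pos_of_ne_zero (NeZero.ne L)
  have hL4 : (0 : ℝ) < (L : ℝ) ^ 4 := by positivity
  have hD0 : 0 < tdistT (cM M₀) y y' := by linarith
  rw [king_blockCov_sub_noise_apply (cM M₀) hL ha hm (y + unitVec (cM M₀) ν) y', king_blockCov_sub_noise_apply (cM M₀) hL ha hm y y', ← mul_sub,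
    ← Finset.sum_sub_distrib]
  have hL31 : ((L : ℝ) ^ (3 + 1)) = (L : ℝ) ^ 4 := by norm_num
  rw [hL31, abs_mul, abs_of_pos (inv_pos.mpr hL4)]
  have hterm : ∀ j j' : Fin 4 → Fin L,
      |(lapF (fine L (cM M₀)) ((L : ℝ) ^ 2) m2)⁻¹ (site L (cM M₀) (y + unitVec (cM M₀) ν) j) (site L (cM M₀) y' j') - (lapF (fine L (cM M₀)) ((L : ℝ) ^ 2) m2)⁻¹ (site L (cM M₀) y j) (site L (cM M₀) y' j')|
        ≤ 27 * 4940000 / ((L : ℝ) ^ 4 * tdistT (cM M₀) y y' ^ 3) := by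
    intro j j'
    rw [site_add_unitVec_eq_add_nsmul L (cM M₀) y j ν]
    exact abs_lapF_inv_blockShift_sub_le L M₀ hm (site L (cM M₀) y j) (site L (cM M₀) y' j') ν hD
      (by have := mul_tdistT_blocks_le L (cM M₀) y y' j j'; linarith)
  calc ((L : ℝ) ^ 4)⁻¹ * |∑ j : Fin 4 → Fin L, (∑ j' : Fin 4 → Fin L, (lapF (fine L (cM M₀)) ((L : ℝ) ^ 2) m2)⁻¹ (site L (cM M₀) (y + unitVec (cM M₀) ν) j) (site L (cM M₀) y' j')
          - ∑ j' : Fin 4 → Fin L, (lapF (fine L (cM M₀)) ((L : ℝ) ^ 2) m2)⁻¹ (site L (cM M₀) y j) (site L (cM M₀) y' j'))|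
      ≤ ((L : ℝ) ^ 4)⁻¹ * ∑ j : Fin 4 → Fin L, ∑ j' : Fin 4 → Fin L, 27 * 4940000 / ((L : ℝ) ^ 4 * tdistT (cM M₀) y y' ^ 3) := by
        refine mul_le_mul_of_nonneg_left ?_ (inv_pos.mpr hL4).le
        refine (Finset.abs_sum_le_sum_abs _ _).trans (Finset.sum_le_sum fun j _ => ?_)
        rw [← Finset.sum_sub_distrib]
        exact (Finset.abs_sum_le_sum_abs _ _).trans (Finset.sum_le_sum fun j' _ => hterm j j')
    _ = 27 * 4940000 / tdistT (cM M₀) y y' ^ 3 := by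
        rw [Finset.sum_const, Finset.card_univ, nsmul_eq_mul, Finset.sum_const, Finset.card_univ, nsmul_eq_mul, card_offsets_four]
        field_simp

/-- ★★ THE NEAR ZONE (all `y, y′`): `|(C−a⁻¹1)(y+ê_ν,y′) − (C−a⁻¹1)(y,y′)| ≤ 2∕m²` (both values lie in `[0, 1∕m²]`, PART Ϻ-e). [cite: King1986, (2.14) p.653, (4.45) p.675] -/
theorem abs_blockCov_grad_le_near (ha : 0 < a) (hm : 0 < m2) (y y' : Tor (cM M₀)) (ν : Fin 4) :
    |((effLaplacian L (cM M₀) a ((L : ℝ) ^ 2) m2)⁻¹ - a⁻¹ • (1 : Matrix (Tor (cM M₀)) (Tor (cM M₀)) ℝ)) (y + unitVec (cM M₀) ν) y'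
        - ((effLaplacian L (cM M₀) a ((L : ℝ) ^ 2) m2)⁻¹ - a⁻¹ • (1 : Matrix (Tor (cM M₀)) (Tor (cM M₀)) ℝ)) y y'| ≤ 2 / m2 := by
  have h1 := king_blockCov_sub_noise_nonneg L (cM M₀) ha hm (y + unitVec (cM M₀) ν) y'
  have h2 := king_blockCov_sub_noise_le_inv_mass L (cM M₀) ha hm (y + unitVec (cM M₀) ν) y'
  have h3 := king_blockCov_sub_noise_nonneg L (cM M₀) ha hm y y'
  have h4 := king_blockCov_sub_noise_le_inv_mass L (cM M₀) ha hm y y'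
  rw [abs_le]
  constructor <;> [rw [div_eq_mul_inv]; rw [div_eq_mul_inv]] <;> nlinarith [inv_pos.mpr hm]

/-- ★★★★ **THE η-UNIFORM INVERSE-CUBE LAW FOR THE BLOCK GRADIENT OF NE2's UNIT LAYER** (first slot): for ALL `y, y′` in the block torus `(ℤ∕M₀)⁴`, every direction `ν`, EVERY block size `L ≥ 1`,
EVERY volume `M₀ ≥ 1` (`a, m² > 0`): `|(C − a⁻¹1)(y+ê_ν,y′) − (C − a⁻¹1)(y,y′)| ≤ (316160000 + 128∕m²)∕(1 + dist_M(y,y′))³` — the cluster property of the block field ONE DERIVATIVE UP, in BLOCK units,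
uniform in the spacing `η = 1∕L` of the fine field it came from. [cite: King1986, (2.13)–(2.14) p.653, (4.34) p.674, (4.44)–(4.45) p.675, (3.63) p.663; Balaban1984PropagatorsI, (1.29) p.23] -/
theorem king_blockCov_grad_powerLaw_eta_uniform (ha : 0 < a) (hm : 0 < m2) (y y' : Tor (cM M₀)) (ν : Fin 4) :
    |((effLaplacian L (cM M₀) a ((L : ℝ) ^ 2) m2)⁻¹ - a⁻¹ • (1 : Matrix (Tor (cM M₀)) (Tor (cM M₀)) ℝ)) (y + unitVec (cM M₀) ν) y'
        - ((effLaplacian L (cM M₀) a ((L : ℝ) ^ 2) m2)⁻¹ - a⁻¹ • (1 : Matrix (Tor (cM M₀)) (Tor (cM M₀)) ℝ)) y y'|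
      ≤ (316160000 + 128 / m2) / (1 + tdistT (cM M₀) y y') ^ 3 := by
  have hD0 := tdistT_nonneg (cM M₀) y y'
  set D := tdistT (cM M₀) y y' with hDdef
  rcases le_or_gt 3 D with hD | hD
  · refine (abs_blockCov_grad_le_far L M₀ ha hm y y' ν hD).trans ?_
    -- `27∕D³ ≤ 64∕(1+D)³` for `D ≥ 3`
    have hD3 : 0 < D ^ 3 := by positivity
    have hkey : 27 * 4940000 / D ^ 3 ≤ 316160000 / (1 + D) ^ 3 := by
      rw [div_le_div_iff₀ hD3 (by positivity)]
      have h : 27 * (1 + D) ^ 3 ≤ 64 * D ^ 3 := by nlinarith [pow_le_pow_left₀ (by positivity : (0:ℝ) ≤ 3 * (1 + D)) (by linarith : 3 * (1 + D) ≤ 4 * D) 3]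
      nlinarith
    have h2 : 316160000 / (1 + D) ^ 3 ≤ (316160000 + 128 / m2) / (1 + D) ^ 3 :=
      div_le_div_of_nonneg_right (by have := inv_pos.mpr hm; rw [div_eq_mul_inv]; nlinarith) (by positivity)
    exact hkey.trans h2
  · refine (abs_blockCov_grad_le_near L M₀ ha hm y y' ν).trans ?_
    -- `2∕m² ≤ 128m⁻²∕(1+D)³` for `D < 3`
    have h64 : (1 + D) ^ 3 ≤ 64 := by
      have h4 : 1 + D ≤ 4 := by linarith
      calc (1 + D) ^ 3 ≤ (4 : ℝ) ^ 3 := pow_le_pow_left₀ (by linarith) h4 3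
        _ = 64 := by norm_num
    rw [le_div_iff₀ (by positivity)]
    calc 2 / m2 * (1 + D) ^ 3 ≤ 2 / m2 * 64 := mul_le_mul_of_nonneg_left h64 (by positivity)
      _ = 128 / m2 := by ring
      _ ≤ 316160000 + 128 / m2 := by linarith

/-- ★★★★ **… SECOND SLOT**: `|(C − a⁻¹1)(y,y′+ê_ν) − (C − a⁻¹1)(y,y′)| ≤ (316160000 + 128∕m²)∕(1 + dist_M(y,y′))³` (symmetry of `C`). [cite: King1986, (2.14) p.653, (4.45) p.675, (3.63) p.663] -/
theorem king_blockCov_grad_snd_powerLaw_eta_uniform (ha : 0 < a) (hm : 0 < m2) (y y' : Tor (cM M₀)) (ν : Fin 4) :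
    |((effLaplacian L (cM M₀) a ((L : ℝ) ^ 2) m2)⁻¹ - a⁻¹ • (1 : Matrix (Tor (cM M₀)) (Tor (cM M₀)) ℝ)) y (y' + unitVec (cM M₀) ν)
        - ((effLaplacian L (cM M₀) a ((L : ℝ) ^ 2) m2)⁻¹ - a⁻¹ • (1 : Matrix (Tor (cM M₀)) (Tor (cM M₀)) ℝ)) y y'|
      ≤ (316160000 + 128 / m2) / (1 + tdistT (cM M₀) y y') ^ 3 := by
  rw [king_blockCov_sub_noise_symm L M₀ ha hm y (y' + unitVec (cM M₀) ν), king_blockCov_sub_noise_symm L M₀ ha hm y y', tdistT_symm]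
  exact king_blockCov_grad_powerLaw_eta_uniform L M₀ ha hm y' y ν

/-- ★★★ **WHAT THE CURVED CASE ADDS** (FAN-OUT v1.1 §N15 row s3, the one line, as a theorem about NE2's unit layer at `A = 0`): both the η-uniform inverse-square law (PART Ϻ-e) and the η-uniform
inverse-cube law for the block gradient (this file, both slots) are DECIDED for King's block-field covariance, every `L`, every `M₀`; at a unitary background `U ≠ 1` PART Ϻ-e's domination
`‖blk((Δ_eff(U))⁻¹) − a⁻¹1‖ ≤ (C − a⁻¹1)_{flat}` transfers the SQUARE law with the same constant, but a domination of KERNELS does not dominate their DIFFERENCES — the covariant block-gradient law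
is what Bałaban's case adds ([B9] (3.133)∕(3.42)-type gradient decay of `C^{(k)}(U)`, node N15's open cell). [cite: King1986, (2.14) p.653, (3.63) p.663; Balaban1985BackgroundPropagators, Thm 3.1 (3.42) p.397] -/
theorem king_blockCov_grad_what_the_curved_case_adds (ha : 0 < a) (hm : 0 < m2) :
    ∀ (y y' : Tor (cM M₀)) (ν : Fin 4),
      0 ≤ ((effLaplacian L (cM M₀) a ((L : ℝ) ^ 2) m2)⁻¹ - a⁻¹ • (1 : Matrix (Tor (cM M₀)) (Tor (cM M₀)) ℝ)) y y'
      ∧ ((effLaplacian L (cM M₀) a ((L : ℝ) ^ 2) m2)⁻¹ - a⁻¹ • (1 : Matrix (Tor (cM M₀)) (Tor (cM M₀)) ℝ)) y y' ≤ 8 * (34016 + 10 / m2) / (1 + tdistT (cM M₀) y y' ^ 2)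
      ∧ |((effLaplacian L (cM M₀) a ((L : ℝ) ^ 2) m2)⁻¹ - a⁻¹ • (1 : Matrix (Tor (cM M₀)) (Tor (cM M₀)) ℝ)) (y + unitVec (cM M₀) ν) y'
          - ((effLaplacian L (cM M₀) a ((L : ℝ) ^ 2) m2)⁻¹ - a⁻¹ • (1 : Matrix (Tor (cM M₀)) (Tor (cM M₀)) ℝ)) y y'| ≤ (316160000 + 128 / m2) / (1 + tdistT (cM M₀) y y') ^ 3
      ∧ |((effLaplacian L (cM M₀) a ((L : ℝ) ^ 2) m2)⁻¹ - a⁻¹ • (1 : Matrix (Tor (cM M₀)) (Tor (cM M₀)) ℝ)) y (y' + unitVec (cM M₀) ν)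
          - ((effLaplacian L (cM M₀) a ((L : ℝ) ^ 2) m2)⁻¹ - a⁻¹ • (1 : Matrix (Tor (cM M₀)) (Tor (cM M₀)) ℝ)) y y'| ≤ (316160000 + 128 / m2) / (1 + tdistT (cM M₀) y y') ^ 3 :=
  fun y y' ν => ⟨(king_blockCov_powerLaw_eta_uniform L M₀ ha hm y y').1, (king_blockCov_powerLaw_eta_uniform L M₀ ha hm y y').2,
    king_blockCov_grad_powerLaw_eta_uniform L M₀ ha hm y y' ν, king_blockCov_grad_snd_powerLaw_eta_uniform L M₀ ha hm y y' ν⟩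

end UnitLayer

end Summit.QuantumFields.YangMills.BalabanUVNodes.N15KingModelRung.HeatKernel

end
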